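import Literature.AlgebraicGeometry.Motives.GrassmannianRepresentable
import Literature.AlgebraicGeometry.Motives.OpenSubfunctorCoverCharts
import Literature.AlgebraicGeometry.Motives.GrassmannianValuativeCriterion
import Mathlib.AlgebraicGeometry.Noetherian
import Mathlib.AlgebraicGeometry.Morphisms.FiniteType
import Mathlib.Algebra.Ring.ULift
import HarnessLib

/-!
# The Grassmannian scheme: the chart schemes are an open cover; Noetherian, of finite type,
# SEPARATED AND PROPER over `ℤ`

Topic `AlgebraicGeometry/Motives`; namespace `Literature.AlgebraicGeometry.Motives.Grassmannian`.  THEOREMS ONLY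
(no definition, no instance, no notation, no named fact, no `sorry`).  (h4) brick (A7) of the cell's F-DAG hand
«Grassmannian as a scheme»: the TOPOLOGICAL / FINITE-TYPE side conditions of the valuative road to properness
([GortzWedhorn2020, Cor. 8.15 (p. 216)]: `Grass_{d,n}` is of finite type over `ℤ`, covered by the finitely many
affine spaces `U_I ≅ 𝔸^{d(n-d)}`; Example 15.12: hence proper by the valuative criterion).

Inputs (all ★): the representability theorem `isRepresentable_grassmannianSheaf[_of_basis]` ((A4),
`GrassmannianRepresentable`) assembled by `isRepresentable_of_openCondition_cover` from the standard charts
`chartMap k M b I hI : h_{Spec ℤ[X_{σ_I × Fin k}]} ⟶ grassmannianSheaf M k` (`GrassmannianChartScheme[Range]`,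
`GrassmannianChartLocusScheme`), and the companion `exists_iso_openCover_of_openCondition_cover`
(`OpenSubfunctorCoverCharts`: the charts glue to an open cover of SOME representing scheme).  Here:

* §0 (generic) **`exists_openCover_reprX_of_openCondition_cover`** — the same open cover, transported to the
  CANONICAL representing object `F.reprX` (Mathlib `Functor.reprX` / `reprW`) along the Yoneda-preimage of
  `h_Y ≅ F ≅ h_{reprX}`; so it speaks about ★ `grassmannianScheme M k := (grassmannianSheaf M k).obj.reprX`.
* §1 **`exists_openImmersion_chartScheme_cover`** — open immersions `g_I : chartScheme k I ⟶ grassmannianScheme M k`,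
  one for each injective `I : Fin k → J` (`b : J → M` a `ℤ`-basis), JOINTLY SURJECTIVE, whose functor-of-points is the
  chart map: `pointsEquiv (a ≫ g_I) = (chartMap k M b I hI)(a)`.
* §2 (for `M` finite free, under `[(grassmannianSheaf M k).obj.IsRepresentable]` as in ★ `GrassmannianSheaf` §4)
  **`isNoetherian`** (finitely many Noetherian affine charts), `isLocallyNoetherian`, `compactSpace`,
  `quasiSeparatedSpace`, and the morphism forms **`quasiCompact_terminal_from`**, **`quasiSeparated_terminal_from`**,
  **`locallyOfFiniteType_terminal_from`** — exactly the three instance binders of the valuative-criterion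
  properness theorem ★ (A6) `isProper_of_quasiCompact` (`GrassmannianValuativeCriterion`, B-p21 (g16)).
* §3 the payoff: **`isSeparated`** and **`isProper_terminal_from : IsProper (terminal.from (grassmannianScheme M k))`**
  — THE GRASSMANNIAN OF A FINITE FREE ABELIAN GROUP IS PROPER OVER `ℤ` ([GortzWedhorn2020, Example 15.12];
  valuative road: ★ (A6) `valuativeCriterion` + §2), with `universallyClosed_terminal_from`, `isSeparated_terminal_from`.

References: [GortzWedhorn2020] (8.4) Lemma 8.13, Cor. 8.15 (p. 216), Thm. 8.9 (p. 212); [StacksProject, Tag 089T].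
Cell `hodgecm-mathlib` (D-0151), count-neutral Mathlib-side capital; nothing here is about HC — HC_CM is proved only
modulo the 7 printed citations until rung 0 closes.
-/

universe u

open CategoryTheory CategoryTheory.Limits Opposite _root_.AlgebraicGeometry

namespace Literature.AlgebraicGeometry.Motives

/-! ## §0 The charts are an open cover of the canonical representing scheme `F.reprX` -/

/-- **The charts glue to an open cover of `F.reprX`** (Görtz–Wedhorn Thm. 8.9, proof, read on the canonical
representing object): under the hypotheses of ★ `isRepresentable_of_openCondition_cover` and for ANY instance
`[F.IsRepresentable]`, there are OPEN IMMERSIONS `g i : X i ⟶ F.reprX` covering `F.reprX` with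
`h_{g i} ≫ F.reprW.hom = f i`. [cite: GortzWedhorn2020, Thm. 8.9 (p. 212)] -/
theorem exists_openCover_reprX_of_openCondition_cover
    (F : Sheaf Scheme.zariskiTopology.{u} (Type u))
    {ι : Type u} {X : ι → Scheme.{u}} (f : ∀ i, yoneda.obj (X i) ⟶ F.1)
    (hinj : ∀ (i : ι) (T : Scheme.{u}), Function.Injective ((f i).app (op T)))
    (U : ∀ (i : ι) {T : Scheme.{u}}, F.1.obj (op T) → T.Opens)
    (hU : ∀ (i : ι) {T T' : Scheme.{u}} (x : F.1.obj (op T)) (h : T' ⟶ T),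
      F.1.map h.op x ∈ Set.range ((f i).app (op T')) ↔ Set.range h ⊆ (U i x : Set T))
    (hcover : ∀ (K : Type u) [Field K] (x : F.1.obj (op (Spec (CommRingCat.of K)))),
      ∃ i, x ∈ Set.range ((f i).app (op (Spec (CommRingCat.of K)))))
    [F.1.IsRepresentable] :
    ∃ g : ∀ i, X i ⟶ F.1.reprX,
      (∀ i, IsOpenImmersion (g i)) ∧ (∀ y : F.1.reprX, ∃ i, y ∈ Set.range (g i)) ∧
      ∀ i, yoneda.map (g i) ≫ F.1.reprW.hom = f i := by
  obtain ⟨Y, e, g, hg, hcov, hcomp⟩ :=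
    exists_iso_openCover_of_openCondition_cover F f hinj U hU hcover
  let φ : Y ≅ F.1.reprX := Yoneda.fullyFaithful.preimageIso (e ≪≫ F.1.reprW.symm)
  have hφ : yoneda.map φ.hom = e.hom ≫ F.1.reprW.inv := by
    simp only [φ, Functor.FullyFaithful.preimageIso_hom, Functor.FullyFaithful.map_preimage,
      Iso.trans_hom, Iso.symm_hom]
  refine ⟨fun i => g i ≫ φ.hom, fun i => inferInstance, fun y => ?_, fun i => ?_⟩
  · obtain ⟨i, z, hz⟩ := hcov (φ.inv y)
    refine ⟨i, z, ?_⟩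
    rw [Scheme.Hom.comp_apply, hz, ← Scheme.Hom.comp_apply, Iso.inv_hom_id]
    rfl
  · rw [yoneda.map_comp, Category.assoc, hφ, Category.assoc, Iso.inv_hom_id, Category.comp_id, hcomp]

namespace Grassmannian

/-! ## §1 The chart schemes are an open cover of `grassmannianScheme M k` -/

section Cover

variable (k : ℕ) (M : Type u) [AddCommGroup M] {J : Type u} (b : Module.Basis J ℤ M)

/-- **The standard charts are an open cover of the Grassmannian scheme.**  For a `ℤ`-basis `b : J → M` there are
OPEN IMMERSIONS `g_I : chartScheme k I = Spec ℤ[X_{σ_I × Fin k}] ⟶ grassmannianScheme M k`, one for each injective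
`I : Fin k → J`, which jointly cover `grassmannianScheme M k` and whose functor of points is the chart map
`chartMap k M b I hI` (`pointsEquiv (a ≫ g_I) = Gr(a) chartElem`).
[cite: GortzWedhorn2020, (8.4), Lemma 8.13 (p. 215)] [cite: StacksProject, Tag 089T] -/
theorem exists_openImmersion_chartScheme_cover [(grassmannianSheaf M k).obj.IsRepresentable] :
    ∃ g : ∀ I : {I : Fin k → J // Function.Injective I}, chartScheme k I.1 ⟶ grassmannianScheme M k,
      (∀ I, IsOpenImmersion (g I)) ∧
      (∀ y : grassmannianScheme M k, ∃ I, y ∈ Set.range (g I)) ∧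
      ∀ (I) (T : Scheme.{u}) (a : T ⟶ chartScheme k I.1),
        pointsEquiv M k T (a ≫ g I) = (chartMap k M b I.1 I.2).app (op T) a := by
  obtain ⟨g, hg, hcov, hcomp⟩ := exists_openCover_reprX_of_openCondition_cover (grassmannianSheaf M k)
    (ι := {I : Fin k → J // Function.Injective I}) (X := fun I => chartScheme k I.1)
    (fun I => chartMap k M b I.1 I.2) (fun I T => chartMap_app_injective k M b I.1 I.2 T)
    (fun I {T} y => chartLocus (⇑b ∘ I.1) y)
    (fun I {T T'} y h => by rw [range_chartMap_app_eq, ← map_mem_chartSubsheaf_iff])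
    (fun K _ y => by
      obtain ⟨I, hI⟩ := exists_mem_range_chartMap_app_of_field k M b K y
      exact ⟨I, hI⟩)
  refine ⟨g, hg, hcov, fun I T a => ?_⟩
  have h := congrArg (fun η => η.app (op T) a) (hcomp I)
  exact h

end Cover

/-! ## §2 Noetherian, quasi-compact, quasi-separated, locally of finite type -/

section Properties

variable (M : Type u) [AddCommGroup M] (k : ℕ) [(grassmannianSheaf M k).obj.IsRepresentable]

/-- The chart index set `{I : Fin k → J // I injective}` is finite for a finite basis index `J`. [folklore] -/
private theorem finite_chartIndex {J : Type u} [Finite J] (k : ℕ) :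
    Finite {I : Fin k → J // Function.Injective I} :=
  Subtype.finite

/-- The chart ring `ℤ[X_{σ_I × Fin k}]` is Noetherian for a finite basis index `J`. [folklore] -/
private theorem isNoetherianRing_chartRing {J : Type u} [Finite J] (k : ℕ) (I : Fin k → J) :
    IsNoetherianRing (chartRing k I) :=
  inferInstanceAs (IsNoetherianRing (MvPolynomial ({j : J // j ∉ Set.range I} × Fin k) ℤ))

/-- The structure morphism `Spec ℤ[X_σ] → ⊤` of a chart is locally of finite type for `σ` finite. [folklore] -/
private theorem locallyOfFiniteType_terminal_from_chartScheme {J : Type u} [Finite J] (k : ℕ)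
    (I : Fin k → J) : LocallyOfFiniteType (terminal.from (chartScheme k I)) := by
  have := isIso_of_isTerminal specULiftZIsTerminal.{u} terminalIsTerminal (terminal.from _)
  let φ : ULift.{u} ℤ →+* MvPolynomial ({j : J // j ∉ Set.range I} × Fin k) ℤ :=
    (algebraMap ℤ _).comp ULift.ringEquiv.toRingHom
  change LocallyOfFiniteType (terminal.from (Spec (CommRingCat.of (MvPolynomial _ ℤ))))
  rw [← terminal.comp_from (Spec.map (CommRingCat.ofHom φ)),
    MorphismProperty.cancel_right_of_respectsIso (P := @LocallyOfFiniteType),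
    HasRingHomProperty.Spec_iff (P := @LocallyOfFiniteType)]
  change φ.FiniteType
  exact RingHom.FiniteType.comp (RingHom.finiteType_algebraMap.mpr inferInstance)
    (RingHom.FiniteType.of_surjective _ ULift.ringEquiv.surjective)

variable [Module.Finite ℤ M] [Module.Free ℤ M]

/-- **The Grassmannian scheme of a finite free abelian group is Noetherian** (finite open cover by the Noetherian
affine charts `Spec ℤ[X_{σ_I × Fin k}]`). [cite: GortzWedhorn2020, (8.4), Lemma 8.13 (p. 215)] -/
theorem isNoetherian : IsNoetherian (grassmannianScheme M k) := by
  obtain ⟨g, hg, hcov, -⟩ :=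
    exists_openImmersion_chartScheme_cover k M (Module.Free.chooseBasis ℤ M)
  let 𝒰 : (grassmannianScheme M k).OpenCover :=
    Scheme.Cover.mkOfCovers {I : Fin k → Module.Free.ChooseBasisIndex ℤ M // Function.Injective I}
      (fun I => chartScheme k I.1) g (fun y => by
        obtain ⟨I, z, hz⟩ := hcov y
        exact ⟨I, z, hz⟩) hg
  haveI : Finite 𝒰.I₀ := finite_chartIndex k
  haveI hN : ∀ I, IsNoetherian (𝒰.X I) := fun I => by
    haveI := isNoetherianRing_chartRing k I.1
    exact (inferInstance : IsNoetherian (Spec (chartRing k I.1)))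
  haveI : IsLocallyNoetherian (grassmannianScheme M k) :=
    (isLocallyNoetherian_iff_openCover 𝒰).mpr fun I => inferInstance
  haveI : CompactSpace (grassmannianScheme M k) := Scheme.OpenCover.compactSpace 𝒰
  exact {}

/-- The Grassmannian scheme of a finite free abelian group is locally Noetherian.
[cite: GortzWedhorn2020, (8.4), Lemma 8.13 (p. 215)] -/
theorem isLocallyNoetherian : IsLocallyNoetherian (grassmannianScheme M k) :=
  (isNoetherian M k).toIsLocallyNoetherian

/-- **The Grassmannian scheme of a finite free abelian group is quasi-compact** (finitely many affine charts).
[cite: GortzWedhorn2020, Cor. 8.15 (p. 216)] -/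
theorem compactSpace : CompactSpace (grassmannianScheme M k) :=
  (isNoetherian M k).toCompactSpace

/-- The Grassmannian scheme of a finite free abelian group is quasi-separated (locally Noetherian schemes are).
[cite: GortzWedhorn2020, Cor. 8.15 (p. 216)] -/
theorem quasiSeparatedSpace : QuasiSeparatedSpace (grassmannianScheme M k) := by
  haveI := isLocallyNoetherian M k
  infer_instance

/-- `grassmannianScheme M k → ⊤` is quasi-compact. [cite: GortzWedhorn2020, Cor. 8.15 (p. 216)] -/
theorem quasiCompact_terminal_from : QuasiCompact (terminal.from (grassmannianScheme M k)) :=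
  (compactSpace_iff_quasiCompact _).mp (compactSpace M k)

/-- `grassmannianScheme M k → ⊤` is quasi-separated. [cite: GortzWedhorn2020, Cor. 8.15 (p. 216)] -/
theorem quasiSeparated_terminal_from : QuasiSeparated (terminal.from (grassmannianScheme M k)) :=
  (quasiSeparatedSpace_iff_quasiSeparated _).mp (quasiSeparatedSpace M k)

/-- **`grassmannianScheme M k → ⊤` is locally of finite type** (local on the source over the chart cover; each
chart is an affine space of finite dimension over `ℤ`). [cite: GortzWedhorn2020, Cor. 8.15 (p. 216)] -/
theorem locallyOfFiniteType_terminal_from : LocallyOfFiniteType (terminal.from (grassmannianScheme M k)) := by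
  obtain ⟨g, hg, hcov, -⟩ :=
    exists_openImmersion_chartScheme_cover k M (Module.Free.chooseBasis ℤ M)
  let 𝒰 : (grassmannianScheme M k).OpenCover :=
    Scheme.Cover.mkOfCovers {I : Fin k → Module.Free.ChooseBasisIndex ℤ M // Function.Injective I}
      (fun I => chartScheme k I.1) g (fun y => by
        obtain ⟨I, z, hz⟩ := hcov y
        exact ⟨I, z, hz⟩) hg
  refine IsZariskiLocalAtSource.of_openCover 𝒰 fun I => ?_
  rw [terminal.comp_from]
  exact locallyOfFiniteType_terminal_from_chartScheme k I.1

/-! ## §3 Separated and proper over `ℤ` -/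

/-- **The Grassmannian scheme of a finite free abelian group is separated** (valuative criterion ★
`isSeparated_of_quasiSeparated` + quasi-separatedness from §2).
[cite: GortzWedhorn2020, Example 15.12 (Section (15.2), pp. 494–497)] [cite: StacksProject, Tag 01L0] -/
theorem isSeparated : (grassmannianScheme M k).IsSeparated := by
  haveI := quasiSeparated_terminal_from M k
  exact isSeparated_of_quasiSeparated M k

/-- Morphism form: `grassmannianScheme M k → ⊤` is separated.
[cite: GortzWedhorn2020, Example 15.12 (Section (15.2), pp. 494–497)] [cite: StacksProject, Tag 01L0] -/
theorem isSeparated_terminal_from : IsSeparated (terminal.from (grassmannianScheme M k)) :=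
  (isSeparated M k).1

/-- `grassmannianScheme M k → ⊤` is universally closed (valuative criterion ★ `universallyClosed_of_quasiCompact` +
quasi-compactness from §2). [cite: GortzWedhorn2020, Example 15.12 (Section (15.2), pp. 494–497)]
[cite: StacksProject, Tag 01KF] -/
theorem universallyClosed_terminal_from : UniversallyClosed (terminal.from (grassmannianScheme M k)) := by
  haveI := quasiCompact_terminal_from M k
  exact universallyClosed_of_quasiCompact M k

/-- **THE GRASSMANNIAN IS PROPER OVER `ℤ`**: for a finite free abelian group `M` and `k : ℕ`, the structure morphism
`grassmannianScheme M k → ⊤ = Spec ℤ` of the scheme representing `A ↦ Module.Grassmannian A (A ⊗[ℤ] M) k` is proper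
— ★ (A6) `isProper_of_quasiCompact` (Mathlib `IsProper.of_valuativeCriterion`) with its three side conditions
(quasi-compact, quasi-separated, locally of finite type) discharged by §2 from the finite affine chart cover.
[cite: GortzWedhorn2020, Example 15.12 (Section (15.2), pp. 494–497)] [cite: GortzWedhorn2020, Cor. 8.15 (p. 216)]
[cite: StacksProject, Tag 0BX5] -/
theorem isProper_terminal_from : IsProper (terminal.from (grassmannianScheme M k)) := by
  haveI := quasiCompact_terminal_from M k
  haveI := quasiSeparated_terminal_from M k
  haveI := locallyOfFiniteType_terminal_from M k
  exact isProper_of_quasiCompact M k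

end Properties

end Grassmannian

end Literature.AlgebraicGeometry.Motives
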